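import Summits.NavierStokesRegularity.NavierStokesRegularity.Theorems.HeredityAtOne.Negative.NoSwirlCapEighth

/-!
# The capped signed swirl-free stratum `𝒮_k` of the `HeredityAt k` binder, BY NAME: membership, heredity off the
# stratum (the repaired `∀`-form `C′`), emptiness of the stratum — and the lossless split of item 19249

Cell `ns-blowup`, seat `refuter-ns-palasek-19249-disprove-1` (g2; DISPROVER on route `PalasekTowerBreakdown`, item
stmt-NavierStokesRegularity-19249 `HeredityAtOne`). Companion of the def-free `NoSwirlSliceStratum.lean` (same seat):
this file only NAMES the three predicates of the stratum census so that planners, the tribunal and later seats can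
cite them — `InCapStratum k S s` (the `τ_k`-slice of the registered stage `s` is single-signed swirl-free with
Gallay–Šverák cap value `0.35356·√(√((∫η)(∫r²η))·M) < c₁ Y_{k+1}`), `HeredityAtOffStratum k` (heredity for the
registered stages NOT in the stratum — the minimal REPAIRED `∀`-statement `C′` of the refuter protocol, immune to
every no-swirl cap lever by construction) and `CapStratumEmptyAt k` (NO pinned rigid quiet wide design registers a
level-`k` stage in the stratum — a Liouville-type non-registration claim, `EpisodeBaseG|𝒮`-type at `k = 1`) — and
proves the LOSSLESS SPLIT `HeredityAt k ↔ HeredityAtOffStratum k ∧ CapStratumEmptyAt k` (`k ≥ 1`; at `k = 1` by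
the route decl's name). On the stratum heredity IS emptiness: every member is a counterexample
(`not_heredityAt_of_signedNoSwirlSlice_eighth`, no named fact). Sorry-free; no Navier–Stokes object is constructed;
`InCapStratum 1` is EMPTY-IN-PRACTICE (a member is a registered level-1 stage — `EpisodeBaseG`-hard — whose
`τ₁`-slice is a near-extremal signed swirl-free ring, `sup|u|/G ≥ 0.160` of the sharp `0.2165`). No verdict change.
References: Gallay–Šverák 2015 [cite: GallaySverak2016, Prop. 2.6 (2.14)]; Palasek 2026 [cite: Palasek2026ElementaryModel, §4].
-/

noncomputable section

namespace Summit.NavierStokesRegularity.HeredityAtOneNoSwirlStratum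

open Set MeasureTheory
open Literature.Analysis.FluidPDE
open Summit.NavierStokesRegularity.FluidComputer
open Summit.NavierStokesRegularity.FluidComputer.PalasekTowerClayBridge
open Summit.NavierStokesRegularity.NavierStokesRegularity
open Summit.NavierStokesRegularity.HeredityAtOneNoSwirlCap

/-- **Membership of a registered stage in the CAPPED SIGNED SWIRL-FREE STRATUM `𝒮_k`** (constant `0.35356`): its
`τ_k`-slice is axisymmetric and swirl-free with `0 ≤ ω_θ/r ≤ M`, `ω_θ/r` and `r²·ω_θ/r` integrable, and the
Gallay–Šverák all-time cap of its unforced future lies below the next floor,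
`0.35356 · √(√((∫η)(∫r²η)) · M) < c₁ Y_{k+1}`. [cite: GallaySverak2016, Prop. 2.6 (2.14)] -/
def InCapStratum (k : ℕ) (S : Schedule TowerRates.wide)
    (s : Stage 1 TowerRates.wide S (Margins.routeG TowerRates.wide) k) : Prop :=
  ∃ M : ℝ, SignedNoSwirlSlice (s.u (S.τ k)) M ∧
    0.35356 * Real.sqrt (Real.sqrt ((∫ y, angVortQuot (s.u (S.τ k)) y) *
      ∫ y, cylRadius y ^ 2 * angVortQuot (s.u (S.τ k)) y) * M) < S.c₁ * TowerRates.wide.Y (k + 1)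

/-- **Heredity OFF the stratum** (open; never asserted) — the minimal REPAIRED `∀`-statement `C′`: every
registered level-`k` stage of a pinned (`Λ = 8`, `θ = 6/5`) rigid quiet wide design that is NOT in `𝒮_k` extends
to level `k + 1`. [cite: Palasek2026ElementaryModel, §4] -/
@[conjecture] def HeredityAtOffStratum (k : ℕ) : Prop :=
  ∀ S : Schedule TowerRates.wide, S.Pins 8 (6 / 5) → S.Rigid → S.Quiet →
    ∀ s : Stage 1 TowerRates.wide S (Margins.routeG TowerRates.wide) k, ¬ InCapStratum k S s →
      ∃ s' : Stage 1 TowerRates.wide S (Margins.routeG TowerRates.wide) (k + 1), s.Extends s'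

/-- **The stratum is EMPTY at level `k`** (open; never asserted; Liouville-type NON-registration claim): no pinned
rigid quiet wide design registers a level-`k` stage in `𝒮_k`. [cite: Palasek2026ElementaryModel, §4] -/
@[conjecture] def CapStratumEmptyAt (k : ℕ) : Prop :=
  ∀ S : Schedule TowerRates.wide, S.Pins 8 (6 / 5) → S.Rigid → S.Quiet →
    ∀ s : Stage 1 TowerRates.wide S (Margins.routeG TowerRates.wide) k, ¬ InCapStratum k S s

/-- **Every member of `𝒮_k` is a counterexample to `HeredityAt k`** (`k ≥ 1`; the no-swirl cap lever with the
number `0.35356`, no named fact). [cite: GallaySverak2016, Prop. 2.6 (2.14)] [cite: Palasek2026ElementaryModel, §4] -/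
theorem not_inCapStratum_of_heredityAt {k : ℕ} (hk : 1 ≤ k) (h : HeredityAt k)
    {S : Schedule TowerRates.wide} (hP : S.Pins 8 (6 / 5)) (hR : S.Rigid) (hQ : S.Quiet)
    (s : Stage 1 TowerRates.wide S (Margins.routeG TowerRates.wide) k) : ¬ InCapStratum k S s :=
  fun ⟨_, hsl, hlt⟩ => not_heredityAt_of_signedNoSwirlSlice_eighth hk hP hR hQ s hsl hlt h

/-- **THE STRATUM SPLIT (lossless)**: `HeredityAt k ↔ HeredityAtOffStratum k ∧ CapStratumEmptyAt k` for `k ≥ 1` —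
off the stratum heredity is the hand-over claim, ON the stratum heredity IS emptiness. [cite: Palasek2026ElementaryModel, §4] -/
theorem heredityAt_iff_offStratum_and_empty {k : ℕ} (hk : 1 ≤ k) :
    HeredityAt k ↔ HeredityAtOffStratum k ∧ CapStratumEmptyAt k :=
  ⟨fun h => ⟨fun S hP hR hQ s _ => h S hP hR hQ s, fun _ hP hR hQ s => not_inCapStratum_of_heredityAt hk h hP hR hQ s⟩,
    fun h S hP hR hQ s => h.1 S hP hR hQ s (h.2 S hP hR hQ s)⟩

/-- **Item 19249 by the route decl's name**: `PalasekTowerBreakdown.HeredityAtOne ↔ HeredityAtOffStratum 1 ∧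
CapStratumEmptyAt 1` — the item CONTAINS the conjunct "no pinned rigid quiet wide design registers a level-1 stage
whose `τ₁`-slice is a capped signed swirl-free (vortex-ring-type) state". [cite: Palasek2026ElementaryModel, §4] -/
theorem heredityAtOne_iff_offStratum_and_empty :
    Theses.PalasekTowerBreakdown.HeredityAtOne ↔ HeredityAtOffStratum 1 ∧ CapStratumEmptyAt 1 :=
  heredityAtOne_iff.trans (heredityAt_iff_offStratum_and_empty le_rfl)

/-- The emptiness conjunct extracted from item 19249. [cite: Palasek2026ElementaryModel, §4] -/
theorem capStratumEmptyAt_one_of_heredityAtOne (h : Theses.PalasekTowerBreakdown.HeredityAtOne) :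
    CapStratumEmptyAt 1 :=
  (heredityAtOne_iff_offStratum_and_empty.1 h).2

/-- The repaired statement is implied by the item (it is a restriction of its binder). [cite: Palasek2026ElementaryModel, §4] -/
theorem heredityAtOffStratum_one_of_heredityAtOne (h : Theses.PalasekTowerBreakdown.HeredityAtOne) :
    HeredityAtOffStratum 1 :=
  (heredityAtOne_iff_offStratum_and_empty.1 h).1

/-- **The lever, stratum form**: ONE member of `𝒮₁` on a pinned rigid quiet wide design refutes item 19249.
[cite: GallaySverak2016, Prop. 2.6 (2.14)] [cite: Palasek2026ElementaryModel, §4] -/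
theorem heredityAtOne_false_of_inCapStratum {S : Schedule TowerRates.wide} (hP : S.Pins 8 (6 / 5))
    (hR : S.Rigid) (hQ : S.Quiet) (s : Stage 1 TowerRates.wide S (Margins.routeG TowerRates.wide) 1)
    (hs : InCapStratum 1 S s) : ¬ Theses.PalasekTowerBreakdown.HeredityAtOne := fun h =>
  capStratumEmptyAt_one_of_heredityAtOne h S hP hR hQ s hs

/-- Emptiness, symbol by symbol: `CapStratumEmptyAt k` iff NO pinned rigid quiet wide design carries a registered
level-`k` stage in the stratum. [folklore] -/
theorem capStratumEmptyAt_iff_not_exists {k : ℕ} :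
    CapStratumEmptyAt k ↔
      ¬ ∃ (S : Schedule TowerRates.wide) (s : Stage 1 TowerRates.wide S (Margins.routeG TowerRates.wide) k),
        S.Pins 8 (6 / 5) ∧ S.Rigid ∧ S.Quiet ∧ InCapStratum k S s :=
  ⟨fun h ⟨S, s, hP, hR, hQ, hs⟩ => h S hP hR hQ s hs, fun h S hP hR hQ s hs => h ⟨S, s, hP, hR, hQ, hs⟩⟩

/-- A member of `𝒮₁` on a pinned rigid quiet wide design inhabits the witness class `NoSwirlCappedStageAtOne` of
record (with `C := 0.35356`). [cite: GallaySverak2016, Prop. 2.6 (2.14)] -/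
theorem noSwirlCappedStageAtOne_of_inCapStratum {S : Schedule TowerRates.wide} (hP : S.Pins 8 (6 / 5))
    (hR : S.Rigid) (hQ : S.Quiet) (s : Stage 1 TowerRates.wide S (Margins.routeG TowerRates.wide) 1)
    (hs : InCapStratum 1 S s) : NoSwirlCappedStageAtOne := by
  obtain ⟨M, hsl, hlt⟩ := hs
  exact noSwirlCappedStageAtOne_of_eighth hP hR hQ s hsl hlt

/-- **The only regime in which the emptiness conjunct is presently certifiable is the vacuous one**: if NO pinned
rigid quiet wide design registers a level-1 stage at all (`¬ EpisodeBaseG`; item 19179 open) the stratum is empty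
at level 1. [cite: Palasek2026ElementaryModel, §4] -/
theorem capStratumEmptyAt_one_of_not_episodeBaseG (h : ¬ EpisodeBaseG) : CapStratumEmptyAt 1 :=
  fun S hP hR hQ s _ => h ⟨S, hP, hR, hQ, ⟨s⟩⟩

/-- Under BOTH heredity items the stratum is empty at every level `k ≥ 1` (with `HeredityFrom 2` the cap
inequality is even superfluous: `not_signedNoSwirlSlice_of_heredity_holds`). [cite: Palasek2026ElementaryModel, §4] -/
theorem capStratumEmptyAt_of_heredity (h₁ : HeredityAtOne) (h₂ : HeredityFrom 2) {k : ℕ} (hk : 1 ≤ k) :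
    CapStratumEmptyAt k :=
  fun _ hP hR hQ s ⟨M, hsl, _⟩ => not_signedNoSwirlSlice_of_heredity_holds h₁ h₂ hP hR hQ hk s M hsl

end Summit.NavierStokesRegularity.HeredityAtOneNoSwirlStratum

end
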